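import Mathlib
import HarnessLib

/-!
# Capacitance-matrix (Sherman–Morrison–Woodbury) inversion of `1 - R` for a finite-rank `R`

For a finite-rank bounded operator `R x = ∑ i, g i x • f i` on a normed space `E` (vectors `f i : E`,
functionals `g i : E →L[𝕜] 𝕜`, `i` in a finite index type), invertibility of `1 - R` is decided by
the finite *capacitance matrix* `C j i = g j (f i)`: if `1 - C` has a two-sided inverse `N`, then
`1 - R` is a unit of `E →L[𝕜] E` with the explicit inverse
`y ↦ y + ∑ i, (N *ᵥ (fun j => g j y)) i • f i`, whose norm is at most
`1 + ∑ i, ∑ j, ‖N i j‖ * ‖g j‖ * ‖f i‖`.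

This is the finite-dimensional reduction used in validated numerics to certify the inverse of a
Gershgorin/finite-rank–shifted operator (combine with
`Literature.Analysis.OperatorTheory.HasBoundedInverse.sub_of_unit`).

References: W. W. Hager, *Updating the inverse of a matrix*, SIAM Review 31 (1989) 221–239
(Sherman–Morrison–Woodbury); T. Kato, *Perturbation Theory for Linear Operators* (1966), IV-§1.4 and
III-§4.3 (degenerate perturbations).
-/

namespace Literature.Analysis.OperatorTheory

open scoped BigOperators
open Matrix

variable {𝕜 : Type*} [NontriviallyNormedField 𝕜]
variable {E : Type*} [NormedAddCommGroup E] [NormedSpace 𝕜 E]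
variable {ι : Type*} [Fintype ι] [DecidableEq ι]

/-- The finite-rank (degenerate) operator `x ↦ ∑ i, g i x • f i`. [cite: Kato1966, III-§4.3, (4.7)] -/
noncomputable def finiteRank (f : ι → E) (g : ι → E →L[𝕜] 𝕜) : E →L[𝕜] E :=
  ∑ i, (g i).smulRight (f i)

/-- The capacitance matrix `C j i = g j (f i)` of the finite-rank operator `finiteRank f g`
(Kato's `det (δ_jk + (x_j, e_k))` matrix). [cite: Kato1966, III-§4.3, (4.13)] -/
noncomputable def capMatrix (f : ι → E) (g : ι → E →L[𝕜] 𝕜) : Matrix ι ι 𝕜 :=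
  Matrix.of fun j i => g j (f i)

/-- The candidate inverse of `1 - finiteRank f g` built from a matrix `N` (an inverse of `1 - capMatrix f g`):
`y ↦ y + ∑ i, (N *ᵥ (g · y)) i • f i` (Sherman–Morrison–Woodbury). [cite: Kato1966, III-§4.3, (4.13)] -/
noncomputable def capInverse (f : ι → E) (g : ι → E →L[𝕜] 𝕜) (N : Matrix ι ι 𝕜) : E →L[𝕜] E :=
  1 + ∑ i, (∑ j, N i j • g j).smulRight (f i)

omit [DecidableEq ι] in
/-- Pointwise formula for `finiteRank`. [folklore] -/
@[simp] theorem finiteRank_apply (f : ι → E) (g : ι → E →L[𝕜] 𝕜) (x : E) :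
    finiteRank f g x = ∑ i, g i x • f i := by
  simp [finiteRank, ContinuousLinearMap.smulRight_apply]

omit [DecidableEq ι] in
/-- Pointwise formula for `capInverse`. [folklore] -/
theorem capInverse_apply (f : ι → E) (g : ι → E →L[𝕜] 𝕜) (N : Matrix ι ι 𝕜) (y : E) :
    capInverse f g N y = y + ∑ i, (N *ᵥ fun j => g j y) i • f i := by
  simp [capInverse, ContinuousLinearMap.smulRight_apply, Matrix.mulVec, dotProduct, smul_eq_mul]

omit [DecidableEq ι] in
/-- The functionals applied to a finite combination of the `f i`: `g j (∑ i, v i • f i) = (C *ᵥ v) j`. [folklore] -/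
theorem apply_sum_smul (f : ι → E) (g : ι → E →L[𝕜] 𝕜) (v : ι → 𝕜) (j : ι) :
    g j (∑ i, v i • f i) = (capMatrix f g *ᵥ v) j := by
  simp [capMatrix, Matrix.mulVec, dotProduct, map_sum, map_smul, smul_eq_mul, mul_comm]

/-- `(1 - R) ∘ W' = 1` when `(1 - C) * N = 1`. [cite: Kato1966, III-§4.3, (4.13)] -/
theorem one_sub_finiteRank_comp_capInverse (f : ι → E) (g : ι → E →L[𝕜] 𝕜) (N : Matrix ι ι 𝕜)
    (hN : (1 - capMatrix f g) * N = 1) :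
    (1 - finiteRank f g).comp (capInverse f g N) = 1 := by
  ext y
  set c : ι → 𝕜 := fun j => g j y with hc
  have hgW : (fun j => g j (capInverse f g N y)) = c + capMatrix f g *ᵥ (N *ᵥ c) := by
    funext j
    rw [capInverse_apply, map_add, apply_sum_smul]
    simp [hc]
  have hmat : N - capMatrix f g * N = 1 := by
    simpa [sub_mul] using hN
  have key : ∀ i, (N *ᵥ c) i - (c + capMatrix f g *ᵥ (N *ᵥ c)) i = 0 := by
    intro i
    have h1 : (N - capMatrix f g * N) *ᵥ c = c := by rw [hmat, Matrix.one_mulVec]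
    have h2 : ((N - capMatrix f g * N) *ᵥ c) i = (N *ᵥ c) i - (capMatrix f g *ᵥ (N *ᵥ c)) i := by
      rw [Matrix.sub_mulVec, Matrix.mulVec_mulVec]; rfl
    have h3 := congrFun h1 i
    rw [h2] at h3
    simp only [Pi.add_apply]
    rw [← h3]; ring
  calc ((1 - finiteRank f g).comp (capInverse f g N)) y
      = capInverse f g N y - ∑ i, g i (capInverse f g N y) • f i := by
        simp
    _ = y + ∑ i, ((N *ᵥ c) i - (c + capMatrix f g *ᵥ (N *ᵥ c)) i) • f i := by
        have : ∀ i, g i (capInverse f g N y) = (c + capMatrix f g *ᵥ (N *ᵥ c)) i :=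
          fun i => congrFun hgW i
        simp only [this, sub_smul, Finset.sum_sub_distrib]
        rw [capInverse_apply]
        abel
    _ = y := by
        rw [Finset.sum_eq_zero fun i _ => by rw [key i, zero_smul], add_zero]
    _ = (1 : E →L[𝕜] E) y := rfl

/-- `W' ∘ (1 - R) = 1` when `N * (1 - C) = 1`. [cite: Kato1966, III-§4.3, (4.13)] -/
theorem capInverse_comp_one_sub_finiteRank (f : ι → E) (g : ι → E →L[𝕜] 𝕜) (N : Matrix ι ι 𝕜)
    (hN : N * (1 - capMatrix f g) = 1) :
    (capInverse f g N).comp (1 - finiteRank f g) = 1 := by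
  ext x
  set c : ι → 𝕜 := fun j => g j x with hc
  have hg : (fun j => g j ((1 - finiteRank f g) x)) = (1 - capMatrix f g) *ᵥ c := by
    funext j
    show g j (x - finiteRank f g x) = _
    rw [map_sub, finiteRank_apply, apply_sum_smul, Matrix.sub_mulVec, Matrix.one_mulVec]
    rfl
  calc ((capInverse f g N).comp (1 - finiteRank f g)) x
      = (1 - finiteRank f g) x + ∑ i, (N *ᵥ fun j => g j ((1 - finiteRank f g) x)) i • f i := by
        rw [ContinuousLinearMap.comp_apply, capInverse_apply]
    _ = (x - ∑ i, c i • f i) + ∑ i, c i • f i := by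
        rw [hg, Matrix.mulVec_mulVec, hN, Matrix.one_mulVec]
        simp [hc]
    _ = x := by abel
    _ = (1 : E →L[𝕜] E) x := rfl

/-- The unit `1 - finiteRank f g` of `E →L[𝕜] E` with inverse `capInverse f g N`, from a two-sided
matrix inverse `N` of `1 - capMatrix f g`. [cite: Kato1966, III-§4.3, (4.13)] -/
noncomputable def capUnit (f : ι → E) (g : ι → E →L[𝕜] 𝕜) (N : Matrix ι ι 𝕜)
    (hN₁ : (1 - capMatrix f g) * N = 1) (hN₂ : N * (1 - capMatrix f g) = 1) : (E →L[𝕜] E)ˣ where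
  val := 1 - finiteRank f g
  inv := capInverse f g N
  val_inv := by
    rw [ContinuousLinearMap.mul_def, one_sub_finiteRank_comp_capInverse f g N hN₁]
  inv_val := by
    rw [ContinuousLinearMap.mul_def, capInverse_comp_one_sub_finiteRank f g N hN₂]

/-- The unit is `1 - finiteRank f g`. [folklore] -/
@[simp] theorem capUnit_val (f : ι → E) (g : ι → E →L[𝕜] 𝕜) (N : Matrix ι ι 𝕜)
    (hN₁ : (1 - capMatrix f g) * N = 1) (hN₂ : N * (1 - capMatrix f g) = 1) :
    ((capUnit f g N hN₁ hN₂ : (E →L[𝕜] E)ˣ) : E →L[𝕜] E) = 1 - finiteRank f g := rfl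

/-- Its inverse is `capInverse f g N`. [folklore] -/
@[simp] theorem capUnit_inv (f : ι → E) (g : ι → E →L[𝕜] 𝕜) (N : Matrix ι ι 𝕜)
    (hN₁ : (1 - capMatrix f g) * N = 1) (hN₂ : N * (1 - capMatrix f g) = 1) :
    ((capUnit f g N hN₁ hN₂)⁻¹ : (E →L[𝕜] E)ˣ) = capInverse f g N := rfl

omit [DecidableEq ι] in
/-- Norm bound for the explicit inverse: `‖W'‖ ≤ 1 + ∑ i, (∑ j, ‖N i j‖ ‖g j‖) ‖f i‖`. [folklore] -/
theorem norm_capInverse_le (f : ι → E) (g : ι → E →L[𝕜] 𝕜) (N : Matrix ι ι 𝕜) :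
    ‖capInverse f g N‖ ≤ 1 + ∑ i, (∑ j, ‖N i j‖ * ‖g j‖) * ‖f i‖ := by
  unfold capInverse
  refine (norm_add_le _ _).trans (add_le_add ContinuousLinearMap.norm_id_le ?_)
  refine (norm_sum_le _ _).trans (Finset.sum_le_sum fun i _ => ?_)
  rw [ContinuousLinearMap.norm_smulRight_apply]
  refine mul_le_mul_of_nonneg_right ?_ (norm_nonneg _)
  exact (norm_sum_le _ _).trans (Finset.sum_le_sum fun j _ => by rw [norm_smul])

/-- Summary form: if the capacitance matrix `1 - C` is invertible (two-sided inverse `N`), then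
`1 - finiteRank f g` is a unit with `‖inverse‖ ≤ 1 + ∑ i, (∑ j, ‖N i j‖ * ‖g j‖) * ‖f i‖`.
[cite: Kato1966, III-§4.3, (4.13)] -/
theorem exists_unit_one_sub_finiteRank (f : ι → E) (g : ι → E →L[𝕜] 𝕜) (N : Matrix ι ι 𝕜)
    (hN₁ : (1 - capMatrix f g) * N = 1) (hN₂ : N * (1 - capMatrix f g) = 1) :
    ∃ W : (E →L[𝕜] E)ˣ, (W : E →L[𝕜] E) = 1 - finiteRank f g ∧
      ‖((W⁻¹ : (E →L[𝕜] E)ˣ) : E →L[𝕜] E)‖ ≤ 1 + ∑ i, (∑ j, ‖N i j‖ * ‖g j‖) * ‖f i‖ :=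
  ⟨capUnit f g N hN₁ hN₂, rfl, by simpa using norm_capInverse_le f g N⟩

end Literature.Analysis.OperatorTheory
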